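import Mathlib
import Literature.NumberTheory.LFunctions.NumHelpers
import Summits.QuantumFields.BalabanUV.Beta.EriceRemainderEnclosureHistoryAutonomyComparisonAgeCompositionStaticChainStepLeEight
import Summits.QuantumFields.BalabanUV.Beta.EriceRemainderEnclosureHistoryAutonomyComparisonAgeCompositionStaticChainBandsK
import Summits.QuantumFields.BalabanUV.Beta.EriceRemainderEnclosureHistoryAutonomyComparisonAgeCompositionStaticChainBandsL
import Summits.QuantumFields.BalabanUV.Beta.EriceRemainderEnclosureHistoryAutonomyComparisonAgeCompositionStaticChainPairsP7

/-!
# EriceRemainderEnclosureHistoryAutonomyComparisonAgeCompositionStaticChainStepLeSeventeen — (E79zg) THE UNION EXTENDED: the observer step (◆) above EVERY pair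
# of scales with `q = y∕z ≤ 17` — (E79zc) for `q ≤ 8`, nine half-constant bands (E79zd∕ze) for `8 < q ≤ 17`, `y ≥ 12`, and the three residual pairs
# `(9,1), (10,1), (11,1)` (E79zf)

Cell `pub-balaban`, β-function sub-cell, BINDER row D4 «RemainderConst leaves for Bałaban's split» (`HOME/BINDER-OWNERS.md`; owner lineage `b2b-balaban-beta-an4`;
this file by co-owner #2 lineage `b2b-balaban-beta-d4-p2`, generation 70), β-FLOW TEAM duty (1), FREEZE (0) honoured (def-free; imports (E79zc) `…StepLeEight`,
(E79zd∕ze) `…BandsK∕L`, (E79zf) `…PairsP7`, (E79q) `band_pair_step_lattice_half`, (E79y) `pair_pair_step_lattice`, (E79n) `thetabar_le_band`; nothing restated).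

HONEST FRAMING (page 1, verbatim and binding).  *"Discharging BetaPertH makes Bałaban's UV stability UNCONDITIONAL — a real constructive-QFT result; it is
NOT the continuum limit and NOT the Clay problem."*  THIS FILE DISCHARGES NOTHING OF THE KIND.  A finite dispatch over tree theorems — hypotheses of a census,
not facts; the age profile of Bałaban's (1.22) limit functional is NOT PRINTED ([I] p. 298; GAPS G-t4-U2-1∕-2) and NOT asserted.  Row D4 class UNCHANGED
(critical-path width 0; instance 0∕1; D4 DISCHARGE NO DATE).  HONEST DEPENDENCY: continuum YM on T⁴ ⇐ BetaPertH ∧ nine spine estimates (0/9 proved); BetaPertH ⇐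
(D1) ∧ (D4) ∧ CAP+tail; G-an2-4 gates asym, D1 and NE2/3/4.

THE POINT (census sense (α); route (N′); README `HOME/b2b-balaban-beta-d4-p2/g70/e79/README.md`).  **`step_lattice_le_seventeen`**: the step inequality (◆) of the
observer induction above EVERY pair of scales `1 ≤ z < y ≤ 17z`, every level-coupled configuration, every admissible load, natural defect hypothesis
`θ ≤ θ̄(y∕z)`: (E79zc) for `y ≤ 8z`; for `8z < y`, `y ≥ 12` one of the nine half-constant bands `r ∈ [1∕(j+1), 1∕j]`, `j = 8…16` (E79zd∕ze; every polynomial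
coefficient positive); for `y < 12` the pair is `(9,1)`, `(10,1)` or `(11,1)` (E79zf).  WHAT REMAINS: the far family `q > 17` — ONE symbolic theorem by the design
in README §5 (1) (`√q`-scaled constants; coefficientwise `t`-dominance holds for `q ≥ 16`, `numerics/far.py`) — then the assembly of the induction,
identification with the flow, MONO∕MONO′.  NOT CLAIMED: those; the static closure; printed.

WHAT IS PROVED ([folklore]; 0 `def`, 0 sorry).  **`step_lattice_le_seventeen`**.
-/
noncomputable section
open Finset

namespace Summit.QuantumFields.BalabanUV.Beta.EriceRemainderEnclosureHistoryAutonomyComparisonAgeCompositionStaticChainStepLeSeventeen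

open Summit.QuantumFields.BalabanUV.Beta.EriceRemainderEnclosureHistoryAutonomyComparisonAgeCompositionStaticChainBandsMid
open Summit.QuantumFields.BalabanUV.Beta.EriceRemainderEnclosureHistoryAutonomyComparisonAgeCompositionStaticChainBandStepLatticeHalf
open Summit.QuantumFields.BalabanUV.Beta.EriceRemainderEnclosureHistoryAutonomyComparisonAgeCompositionStaticChainPairTemplate
open Literature.NumberTheory.LFunctions.VdC.Num (le_sqrt_of_sq_le)

/-- **THE OBSERVER STEP (◆) ABOVE EVERY PAIR OF SCALES WITH `q = y∕z ≤ 17`** (`1 ≤ z`, `z + 1 ≤ y ≤ 17z`), every level-coupled configuration, every admissible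
load, `κ = 31∕40`, natural defect hypothesis `θ ≤ θ̄(y∕z)`: `y ≤ 8z` → (E79zc) `step_lattice_le_eight`; else `y ≥ 12` → one of the nine bands `[1∕(j+1), 1∕j]`,
`j = 8…16` (packages `facts_k_*` of (E79zd∕ze) through (E79q) `band_pair_step_lattice_half`); else `(y, z) ∈ {(9,1),(10,1),(11,1)}` → (E79y) with (E79zf). [folklore] -/
theorem step_lattice_le_seventeen {n y z : ℕ} {k : ℕ → ℕ} {x a cy cz Sy Sz Ry Rz : ℕ → ℝ} {θ xy Ψyy Ψyz Ψzy Ψzz Ωz σ φ s : ℝ}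
    (hz : 1 ≤ z) (hzy : z + 1 ≤ y) (h17 : y ≤ 17 * z)
    (hn : 0 < n) (hk : ∀ l, l < n → y + 1 ≤ k l) (hx : ∀ l, l < n → 0 ≤ x l)
    (hSy : ∀ l, l < n → Sy l = ∑ m ∈ range y, Real.sqrt ((k l : ℝ) / ((k l : ℝ) + m + 1)))
    (hSz : ∀ l, l < n → Sz l = ∑ m ∈ range z, Real.sqrt ((k l : ℝ) / ((k l : ℝ) + m + 1)))
    (hRy : ∀ l, l < n → Ry l = ∑ m ∈ range (k l), Real.sqrt ((y : ℝ) / ((y : ℝ) + m + 1)))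
    (hRz : ∀ l, l < n → Rz l = ∑ m ∈ range (k l), Real.sqrt ((z : ℝ) / ((z : ℝ) + m + 1)))
    (ha0 : ∀ i, i < n → 0 < a i)
    (ha : ∀ i, i < n → a i = 1 + ∑ l ∈ range n,
      (2 * x l * (∑ m ∈ range (k i), Real.sqrt ((k l : ℝ) / ((k l : ℝ) + m + 1))) / k l) * a l)
    (hcy : ∀ i, i < n → cy i = Ry i / (y : ℝ) + ∑ l ∈ range n,
      (2 * x l * (∑ m ∈ range (k i), Real.sqrt ((k l : ℝ) / ((k l : ℝ) + m + 1))) / k l) * cy l)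
    (hcz : ∀ i, i < n → cz i = Rz i / (z : ℝ) + ∑ l ∈ range n,
      (2 * x l * (∑ m ∈ range (k i), Real.sqrt ((k l : ℝ) / ((k l : ℝ) + m + 1))) / k l) * cz l)
    (hΨyy : Ψyy = ∑ l ∈ range n, (2 * x l * Sy l / k l) * cy l) (hΨyz : Ψyz = ∑ l ∈ range n, (2 * x l * Sz l / k l) * cy l)
    (hΨzy : Ψzy = ∑ l ∈ range n, (2 * x l * Sy l / k l) * cz l) (hΨzz : Ψzz = ∑ l ∈ range n, (2 * x l * Sz l / k l) * cz l)
    (hΩz : Ωz = ∑ l ∈ range n, x l * (z : ℝ) / k l)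
    (hσ : σ = (∑ m ∈ range z, Real.sqrt ((y : ℝ) / ((y : ℝ) + m + 1))) / (y : ℝ))
    (hφ : φ = (∑ m ∈ range y, Real.sqrt ((z : ℝ) / ((z : ℝ) + m + 1))) / (z : ℝ))
    (hs : s = (∑ m ∈ range y, Real.sqrt ((y : ℝ) / ((y : ℝ) + m + 1))) / (y : ℝ))
    (hθ : θ ≤ 1 - ((y : ℝ) / z) / ((y : ℝ) / z + 1) * Real.sqrt (((y : ℝ) / z) / ((y : ℝ) / z + 1)) * Real.exp (-(1 / (2 * ((y : ℝ) / z)))))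
    (hxy : 0 ≤ xy) (hcap : 2 * xy * (s + Ψyy) < 1) :
    (1 + 2 * (31/40:ℝ) * Ψzz) * (1 - Ωz) - (1 - θ) * (xy * (1 + 2 * (31/40:ℝ) * Ψyy))
      ≤ (1 - xy * (1 + 2 * (31/40:ℝ) * Ψyy)) *
        ((1 + 2 * (31/40:ℝ) * Ψzz + 4 * (31/40:ℝ) * xy * ((σ + Ψyz) * (φ + Ψzy)) / (1 - 2 * (s + Ψyy) * xy)) * ((1 - Ωz) - xy / ((y : ℝ) / (z : ℝ)))) := by
  by_cases h8 : y ≤ 8 * z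
  · exact Summit.QuantumFields.BalabanUV.Beta.EriceRemainderEnclosureHistoryAutonomyComparisonAgeCompositionStaticChainStepLeEight.step_lattice_le_eight hz hzy h8 hn hk hx hSy hSz hRy hRz ha0 ha hcy hcz hΨyy hΨyz hΨzy hΨzz hΩz hσ hφ hs hθ hxy hcap
  · have h8' : 8 * z < y := not_le.mp h8
    have hzp : (0 : ℝ) < z := by exact_mod_cast (show 0 < z by omega)
    have hy' : (8 : ℝ) * z < y := by exact_mod_cast h8'
    have h17' : (y : ℝ) ≤ 17 * z := by exact_mod_cast h17
    have hlo : (1/17 : ℝ) * y ≤ z := by linarith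
    have hhi : (z : ℝ) ≤ (1/8 : ℝ) * y := by linarith
    by_cases hy12 : 12 ≤ y
    · have hy12' : (12 : ℝ) ≤ y := by exact_mod_cast hy12
      by_cases c0 : (z : ℝ) ≤ (1/16:ℝ) * y
      · have hzlo : 1 ≤ z := by
          by_contra h
          have : (z : ℝ) ≤ 0 := by exact_mod_cast (show z ≤ 0 by omega)
          linarith [show (1/17:ℝ) * (y : ℝ) ≤ z from hlo]
        exact band_pair_step_lattice_half (rl := (1/17:ℝ)) (rh := (1/16:ℝ)) (y0 := 12) (z0 := 1) (th := (231/2000:ℝ)) (by norm_num) (by norm_num) hy12 hzlo hz hzy hlo c0 Summit.QuantumFields.BalabanUV.Beta.EriceRemainderEnclosureHistoryAutonomyComparisonAgeCompositionStaticChainBandsL.facts_k_1_17_to_1_16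
          hn hk hx hSy hSz hRy hRz ha0 ha hcy hcz hΨyy hΨyz hΨzy hΨzz hΩz hσ hφ hs
          (hθ.trans (thetabar_le_band (ql := (16:ℝ)) (Lc := (485071/500000:ℝ)) (by norm_num) (by rw [le_div_iff₀ hzp]; linarith) (le_sqrt_of_sq_le (by norm_num) (by norm_num)) (by norm_num) (by norm_num))) hxy hcap
      by_cases c1 : (z : ℝ) ≤ (1/15:ℝ) * y
      · have hzlo : 1 ≤ z := by
          by_contra h
          have : (z : ℝ) ≤ 0 := by exact_mod_cast (show z ≤ 0 by omega)
          linarith [show (1/16:ℝ) * (y : ℝ) ≤ z from (not_le.mp c0).le]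
        exact band_pair_step_lattice_half (rl := (1/16:ℝ)) (rh := (1/15:ℝ)) (y0 := 12) (z0 := 1) (th := (613/5000:ℝ)) (by norm_num) (by norm_num) hy12 hzlo hz hzy (not_le.mp c0).le c1 Summit.QuantumFields.BalabanUV.Beta.EriceRemainderEnclosureHistoryAutonomyComparisonAgeCompositionStaticChainBandsL.facts_k_1_16_to_1_15
          hn hk hx hSy hSz hRy hRz ha0 ha hcy hcz hΨyy hΨyz hΨzy hΨzz hΩz hσ hφ hs
          (hθ.trans (thetabar_le_band (ql := (15:ℝ)) (Lc := (193649/200000:ℝ)) (by norm_num) (by rw [le_div_iff₀ hzp]; linarith) (le_sqrt_of_sq_le (by norm_num) (by norm_num)) (by norm_num) (by norm_num))) hxy hcap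
      by_cases c2 : (z : ℝ) ≤ (1/14:ℝ) * y
      · have hzlo : 1 ≤ z := by
          by_contra h
          have : (z : ℝ) ≤ 0 := by exact_mod_cast (show z ≤ 0 by omega)
          linarith [show (1/15:ℝ) * (y : ℝ) ≤ z from (not_le.mp c1).le]
        exact band_pair_step_lattice_half (rl := (1/15:ℝ)) (rh := (1/14:ℝ)) (y0 := 12) (z0 := 1) (th := (653/5000:ℝ)) (by norm_num) (by norm_num) hy12 hzlo hz hzy (not_le.mp c1).le c2 Summit.QuantumFields.BalabanUV.Beta.EriceRemainderEnclosureHistoryAutonomyComparisonAgeCompositionStaticChainBandsL.facts_k_1_15_to_1_14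
          hn hk hx hSy hSz hRy hRz ha0 ha hcy hcz hΨyy hΨyz hΨzy hΨzz hΩz hσ hφ hs
          (hθ.trans (thetabar_le_band (ql := (14:ℝ)) (Lc := (966091/1000000:ℝ)) (by norm_num) (by rw [le_div_iff₀ hzp]; linarith) (le_sqrt_of_sq_le (by norm_num) (by norm_num)) (by norm_num) (by norm_num))) hxy hcap
      by_cases c3 : (z : ℝ) ≤ (1/13:ℝ) * y
      · have hzlo : 1 ≤ z := by
          by_contra h
          have : (z : ℝ) ≤ 0 := by exact_mod_cast (show z ≤ 0 by omega)
          linarith [show (1/14:ℝ) * (y : ℝ) ≤ z from (not_le.mp c2).le]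
        exact band_pair_step_lattice_half (rl := (1/14:ℝ)) (rh := (1/13:ℝ)) (y0 := 12) (z0 := 1) (th := (1397/10000:ℝ)) (by norm_num) (by norm_num) hy12 hzlo hz hzy (not_le.mp c2).le c3 Summit.QuantumFields.BalabanUV.Beta.EriceRemainderEnclosureHistoryAutonomyComparisonAgeCompositionStaticChainBandsL.facts_k_1_14_to_1_13
          hn hk hx hSy hSz hRy hRz ha0 ha hcy hcz hΨyy hΨyz hΨzy hΨzz hΩz hσ hφ hs
          (hθ.trans (thetabar_le_band (ql := (13:ℝ)) (Lc := (120453/125000:ℝ)) (by norm_num) (by rw [le_div_iff₀ hzp]; linarith) (le_sqrt_of_sq_le (by norm_num) (by norm_num)) (by norm_num) (by norm_num))) hxy hcap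
      by_cases c4 : (z : ℝ) ≤ (1/12:ℝ) * y
      · have hzlo : 1 ≤ z := by
          by_contra h
          have : (z : ℝ) ≤ 0 := by exact_mod_cast (show z ≤ 0 by omega)
          linarith [show (1/13:ℝ) * (y : ℝ) ≤ z from (not_le.mp c3).le]
        exact band_pair_step_lattice_half (rl := (1/13:ℝ)) (rh := (1/12:ℝ)) (y0 := 12) (z0 := 1) (th := (1501/10000:ℝ)) (by norm_num) (by norm_num) hy12 hzlo hz hzy (not_le.mp c3).le c4 Summit.QuantumFields.BalabanUV.Beta.EriceRemainderEnclosureHistoryAutonomyComparisonAgeCompositionStaticChainBandsK.facts_k_1_13_to_1_12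
          hn hk hx hSy hSz hRy hRz ha0 ha hcy hcz hΨyy hΨyz hΨzy hΨzz hΩz hσ hφ hs
          (hθ.trans (thetabar_le_band (ql := (12:ℝ)) (Lc := (15012/15625:ℝ)) (by norm_num) (by rw [le_div_iff₀ hzp]; linarith) (le_sqrt_of_sq_le (by norm_num) (by norm_num)) (by norm_num) (by norm_num))) hxy hcap
      by_cases c5 : (z : ℝ) ≤ (1/11:ℝ) * y
      · have hzlo : 1 ≤ z := by
          by_contra h
          have : (z : ℝ) ≤ 0 := by exact_mod_cast (show z ≤ 0 by omega)
          linarith [show (1/12:ℝ) * (y : ℝ) ≤ z from (not_le.mp c4).le]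
        exact band_pair_step_lattice_half (rl := (1/12:ℝ)) (rh := (1/11:ℝ)) (y0 := 12) (z0 := 1) (th := (1623/10000:ℝ)) (by norm_num) (by norm_num) hy12 hzlo hz hzy (not_le.mp c4).le c5 Summit.QuantumFields.BalabanUV.Beta.EriceRemainderEnclosureHistoryAutonomyComparisonAgeCompositionStaticChainBandsK.facts_k_1_12_to_1_11
          hn hk hx hSy hSz hRy hRz ha0 ha hcy hcz hΨyy hΨyz hΨzy hΨzz hΩz hσ hφ hs
          (hθ.trans (thetabar_le_band (ql := (11:ℝ)) (Lc := (957427/1000000:ℝ)) (by norm_num) (by rw [le_div_iff₀ hzp]; linarith) (le_sqrt_of_sq_le (by norm_num) (by norm_num)) (by norm_num) (by norm_num))) hxy hcap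
      by_cases c6 : (z : ℝ) ≤ (1/10:ℝ) * y
      · have hzlo : 2 ≤ z := by
          by_contra h
          have : (z : ℝ) ≤ 1 := by exact_mod_cast (show z ≤ 1 by omega)
          linarith [show (1/11:ℝ) * (y : ℝ) ≤ z from (not_le.mp c5).le]
        exact band_pair_step_lattice_half (rl := (1/11:ℝ)) (rh := (1/10:ℝ)) (y0 := 12) (z0 := 2) (th := (883/5000:ℝ)) (by norm_num) (by norm_num) hy12 hzlo hz hzy (not_le.mp c5).le c6 Summit.QuantumFields.BalabanUV.Beta.EriceRemainderEnclosureHistoryAutonomyComparisonAgeCompositionStaticChainBandsK.facts_k_1_11_to_1_10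
          hn hk hx hSy hSz hRy hRz ha0 ha hcy hcz hΨyy hΨyz hΨzy hΨzz hΩz hσ hφ hs
          (hθ.trans (thetabar_le_band (ql := (10:ℝ)) (Lc := (476731/500000:ℝ)) (by norm_num) (by rw [le_div_iff₀ hzp]; linarith) (le_sqrt_of_sq_le (by norm_num) (by norm_num)) (by norm_num) (by norm_num))) hxy hcap
      by_cases c7 : (z : ℝ) ≤ (1/9:ℝ) * y
      · have hzlo : 2 ≤ z := by
          by_contra h
          have : (z : ℝ) ≤ 1 := by exact_mod_cast (show z ≤ 1 by omega)
          linarith [show (1/10:ℝ) * (y : ℝ) ≤ z from (not_le.mp c6).le]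
        exact band_pair_step_lattice_half (rl := (1/10:ℝ)) (rh := (1/9:ℝ)) (y0 := 12) (z0 := 2) (th := (1937/10000:ℝ)) (by norm_num) (by norm_num) hy12 hzlo hz hzy (not_le.mp c6).le c7 Summit.QuantumFields.BalabanUV.Beta.EriceRemainderEnclosureHistoryAutonomyComparisonAgeCompositionStaticChainBandsK.facts_k_1_10_to_1_9
          hn hk hx hSy hSz hRy hRz ha0 ha hcy hcz hΨyy hΨyz hΨzy hΨzz hΩz hσ hφ hs
          (hθ.trans (thetabar_le_band (ql := (9:ℝ)) (Lc := (948683/1000000:ℝ)) (by norm_num) (by rw [le_div_iff₀ hzp]; linarith) (le_sqrt_of_sq_le (by norm_num) (by norm_num)) (by norm_num) (by norm_num))) hxy hcap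
      have hzlo : 2 ≤ z := by
        by_contra h
        have : (z : ℝ) ≤ 1 := by exact_mod_cast (show z ≤ 1 by omega)
        linarith [show (1/9:ℝ) * (y : ℝ) ≤ z from (not_le.mp c7).le]
      exact band_pair_step_lattice_half (rl := (1/9:ℝ)) (rh := (1/8:ℝ)) (y0 := 12) (z0 := 2) (th := (134/625:ℝ)) (by norm_num) (by norm_num) hy12 hzlo hz hzy (not_le.mp c7).le hhi Summit.QuantumFields.BalabanUV.Beta.EriceRemainderEnclosureHistoryAutonomyComparisonAgeCompositionStaticChainBandsK.facts_k_1_9_to_1_8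
        hn hk hx hSy hSz hRy hRz ha0 ha hcy hcz hΨyy hΨyz hΨzy hΨzz hΩz hσ hφ hs
        (hθ.trans (thetabar_le_band (ql := (8:ℝ)) (Lc := (942809/1000000:ℝ)) (by norm_num) (by rw [le_div_iff₀ hzp]; linarith) (le_sqrt_of_sq_le (by norm_num) (by norm_num)) (by norm_num) (by norm_num))) hxy hcap
    · -- `8z < y < 12`: `z = 1`, `y ∈ {9, 10, 11}`
      have hz1 : z = 1 := by omega
      subst hz1
      have hy9 : 9 ≤ y := by omega
      have hy11 : y ≤ 11 := by omega
      interval_cases y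
      · exact pair_pair_step_lattice (by norm_num) (by norm_num) Summit.QuantumFields.BalabanUV.Beta.EriceRemainderEnclosureHistoryAutonomyComparisonAgeCompositionStaticChainPairsP7.pfacts_9_1 hn hk hx hSy hSz hRy hRz ha0 ha hcy hcz hΨyy hΨyz hΨzy hΨzz hΩz hσ hφ hs hθ hxy hcap
      · exact pair_pair_step_lattice (by norm_num) (by norm_num) Summit.QuantumFields.BalabanUV.Beta.EriceRemainderEnclosureHistoryAutonomyComparisonAgeCompositionStaticChainPairsP7.pfacts_10_1 hn hk hx hSy hSz hRy hRz ha0 ha hcy hcz hΨyy hΨyz hΨzy hΨzz hΩz hσ hφ hs hθ hxy hcap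
      · exact pair_pair_step_lattice (by norm_num) (by norm_num) Summit.QuantumFields.BalabanUV.Beta.EriceRemainderEnclosureHistoryAutonomyComparisonAgeCompositionStaticChainPairsP7.pfacts_11_1 hn hk hx hSy hSz hRy hRz ha0 ha hcy hcz hΨyy hΨyz hΨzy hΨzz hΩz hσ hφ hs hθ hxy hcap

end Summit.QuantumFields.BalabanUV.Beta.EriceRemainderEnclosureHistoryAutonomyComparisonAgeCompositionStaticChainStepLeSeventeen

end
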